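import Summits.CriticalPhenomena.PercolationContinuityZ3.Theses.PercNearOneGluing
import Literature.Probability.Percolation.PercolationProofs
import Literature.Probability.Percolation.ConditionalPositiveAssociationProofs
import Literature.Probability.Percolation.TwoClusterConditionalAssociationProofs
import Summits.CriticalPhenomena.PercolationContinuityZ3.Theorems.PercNearOneGluingAdditiveGluingGoodBase
import Summits.CriticalPhenomena.PercolationContinuityZ3.Theorems.PercNearOneGluingAdditiveGluingGoodTwoRelays
import Summits.CriticalPhenomena.PercolationContinuityZ3.Theorems.PercNearOneGluingAdditiveGluingLemma5AnyRelay
import Summits.CriticalPhenomena.PercolationContinuityZ3.Theorems.PercNearOneGluingAdditiveGluingGoodStep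

/-! TTRL-lite variant V907 of stmt-CriticalPhenomena-4576 -/

namespace Summit.CriticalPhenomena.PercolationContinuityZ3.Theorems

open MeasureTheory Literature.Probability.LatticeModels Literature.Probability.Percolation
open scoped Classical BigOperators

/-- TTRL-lite variant V907 (move `small_case`, op `card_eq:A=3`) of `AdditiveGluing`
(stmt-CriticalPhenomena-4576). The hypotheses `A.card = 3`, `b ∈ A` and `4 ≤ (A.erase b).card`
are jointly contradictory (`(A.erase b).card ≤ A.card = 3 < 4`), so the summed bound holds
vacuously. -/
theorem additiveGluing_var907 :
    ∀ (n : ℕ) (w : Sym2 (Fin n) → unitInterval) (A : Finset (Fin n)) (o b : Fin n) (t : ℝ),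
      A.card = 3 → b ∈ A → 0 < t →
      (∀ a ∈ A, 1 - t ≤ (prodBernoulli w).real (openConn a b)) →
      (∃ a₀ ∈ A, ∃ a₁ ∈ A, ∃ a₂ ∈ A, a₀ ≠ a₁ ∧ a₀ ≠ a₂ ∧ a₁ ≠ a₂ ∧
        (prodBernoulli w).real (openConn a₀ b) = 1 - t ∧
        (prodBernoulli w).real (openConn a₁ b) = 1 - t ∧
        (prodBernoulli w).real (openConn a₂ b) = 1 - t) →
      4 ≤ (A.erase b).card →
      ∑ W : Finset (Fin n), ∑ N : Finset (Fin n),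
        (prodBernoulli w).real {ω : BondConfig (Fin n) |
            (Finset.univ.filter fun v => ω ∈ openConnIn ((↑A : Set (Fin n))ᶜ) o v) = W ∧
            (A.filter fun a => ω ∈ openConnIn (insert a ((↑A : Set (Fin n))ᶜ)) o a) = N} *
          (if N.Nonempty then
            1 - (prodBernoulli (fun e : Sym2 (Fin n) =>
              if ∃ v ∈ W, v ∈ e then (0 : unitInterval) else w e)).real (⋃ a ∈ N, openConn a b)
          else 0) ≤ t := by
  intro n w A o b t hA _hb _ht _hle _hex h4
  exfalso
  have hle : (A.erase b).card ≤ A.card := Finset.card_erase_le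
  omega

end Summit.CriticalPhenomena.PercolationContinuityZ3.Theorems
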